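import Mathlib
import HarnessLib
import Summits.Ventures.LatticeQCDFlow.Scoring.SelfNormalisedReweightingHeavyTail

/-!
# SIGNED scores at the `(1 + ε)`-th moment: the block mean of a signed score with
# `∫ |g|^{1+ε} dν < ∞` deviates by `η` with probability `≤ 40A/(m^ε η^{1+ε})`, and the median over
# `R` blocks is within `η` of `∫ g dν` with probability `≥ 1 − e^{−R/8}` once `160A ≤ m^ε η^{1+ε}`

HONEST FRAMING: exact (Metropolis-corrected) sampling algorithms for lattice gauge theory;
figures of merit are autocorrelation/cost numbers at stated couplings and volumes; no
continuum-physics claim.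

Venture `LatticeQCDFlow` (cell pub-lqcd), topic `Scoring`; FANOUT row 4 (`s0-u1-b`, rung S0-B).
Sequel of row 4's `Scoring/BlockMeanHeavyTail` (the truncation bound
`P(η ≤ |Ḡ_m − ∫ g|) ≤ 5A/(m^ε η^{1+ε})` for a NON-NEGATIVE score, `A = ∫ g^{1+ε} dν`, `0 < ε ≤ 1`)
and `Scoring/SelfNormalisedReweightingHeavyTail` (the printed self-normalised estimate for a
BOUNDED observable `|O| ≤ B`, via the shifted score `w(O + B) ≥ 0`), both imported; they list
'signed scores (split into positive and negative parts)' and 'signed unbounded observables at the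
`(1 + ε)` level' as NOT CLAIMED.  This file does the split: `g = g⁺ − g⁻` with
`(g^±)^{1+ε} ≤ |g|^{1+ε}`, a deviation `≥ η` of the block mean forces a deviation `≥ η/2` of one
part, and `(η/2)^{1+ε} ≥ η^{1+ε}/4` for `ε ≤ 1`; so the signed bound costs a factor `8` over the
non-negative one (`40` for `5`), and row 4's median device (`BlockMedian.measureReal_half_far_le`)
gives the exponential certificate.  The application to the signed score `w·O` of an UNBOUNDED
observable and its printed self-normalised estimate is the next file
(`Scoring/SelfNormalisedReweightingHeavyTailUnbounded`).  NEW WORK of the cell (elementary); no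
definition; nothing cited as a fact (median-of-means under `(1 + ε)`-th moments:
Bubeck–Cesa-Bianchi–Lugosi, IEEE Trans. Inform. Theory 59 (2013) Lemma 2, NAMED ONLY).

## Content (`(Ω, P)` probability space; `ν` a law on `X`; `0 < ε ≤ 1`)

* §1 `posPart_rpow_le_abs_rpow`, `negPart_rpow_le_abs_rpow`, `rpow_half_ge`
  (`η^{1+ε}/4 ≤ (η/2)^{1+ε}`, `ε ≤ 1`), `integrable_posPart_rpow`, `integrable_negPart_rpow`,
  `integrable_of_abs_rpow_moment`;
* §2 **`blockMean_heavyTail_signed_iid`** — `g` measurable, `A = ∫ |g|^{1+ε} dν < ∞`, `m ≥ 1`,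
  `η > 0`: `P(η ≤ |Σ_j g(x_j)/m − ∫ g dν|) ≤ 40A/(m^ε η^{1+ε})`;
  **`blockMean_medianOfBlocks_confidence_heavyTail_signed`** (`160A ≤ m^ε η^{1+ε}` ⇒ `e^{−R/8}`)
  and `blockMean_sampleMedian_confidence_heavyTail_signed` (ANY sample-median selection).

NOT CLAIMED: `ε > 1` (use the `L²` files); estimating `A` (an input); the optimal constant; any
number of ours re-scored.
-/

noncomputable section

namespace Summit.Ventures.LatticeQCDFlow.Scoring.HeavyTailMedian

open MeasureTheory ProbabilityTheory Finset Real Set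
open Summit.Ventures.LatticeQCDFlow.Scoring.BlockMedian
open Summit.Ventures.LatticeQCDFlow.Scoring.AllPairsMedian
open Summit.Ventures.LatticeQCDFlow.Scoring.ReweightingMedian

/-! ## §1 Pointwise and integrability pieces for the positive and negative parts -/

section Parts

variable {z η ε : ℝ}

/-- `(z⁺)^{1+ε} ≤ |z|^{1+ε}` (`ε ≥ -1`). [ours] -/
theorem posPart_rpow_le_abs_rpow (hε : 0 ≤ 1 + ε) : (max z 0) ^ (1 + ε) ≤ |z| ^ (1 + ε) :=
  Real.rpow_le_rpow (le_max_right _ _) (max_le (le_abs_self z) (abs_nonneg z)) hε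

/-- `(z⁻)^{1+ε} ≤ |z|^{1+ε}` (`ε ≥ -1`). [ours] -/
theorem negPart_rpow_le_abs_rpow (hε : 0 ≤ 1 + ε) : (max (-z) 0) ^ (1 + ε) ≤ |z| ^ (1 + ε) :=
  Real.rpow_le_rpow (le_max_right _ _) (max_le (neg_le_abs z) (abs_nonneg z)) hε

/-- `η^{1+ε}/4 ≤ (η/2)^{1+ε}` for `η ≥ 0`, `ε ≤ 1` (`2^{1+ε} ≤ 4`). [ours] -/
theorem rpow_half_ge (hη : 0 ≤ η) (hε1 : ε ≤ 1) :
    η ^ (1 + ε) / 4 ≤ (η / 2) ^ (1 + ε) := by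
  rw [Real.div_rpow hη zero_le_two]
  have h2 : (2 : ℝ) ^ (1 + ε) ≤ 4 := by
    calc (2 : ℝ) ^ (1 + ε) ≤ (2 : ℝ) ^ ((2 : ℕ) : ℝ) :=
          Real.rpow_le_rpow_of_exponent_le one_le_two (by push_cast; linarith)
      _ = 4 := by rw [Real.rpow_natCast]; norm_num
  have h2pos : 0 < (2 : ℝ) ^ (1 + ε) := Real.rpow_pos_of_pos two_pos _
  exact div_le_div_of_nonneg_left (Real.rpow_nonneg hη _) h2pos h2

variable {X : Type*} [MeasurableSpace X] {ν : Measure X} {g : X → ℝ}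

/-- `(g⁺)^{1+ε} ∈ L¹(ν)` from `|g|^{1+ε} ∈ L¹(ν)`, with `∫ (g⁺)^{1+ε} ≤ ∫ |g|^{1+ε}`. [ours] -/
theorem integrable_posPart_rpow (hgm : Measurable g) (hε : 0 ≤ 1 + ε)
    (hA : Integrable (fun a => |g a| ^ (1 + ε)) ν) :
    Integrable (fun a => (max (g a) 0) ^ (1 + ε)) ν
      ∧ ∫ a, (max (g a) 0) ^ (1 + ε) ∂ν ≤ ∫ a, |g a| ^ (1 + ε) ∂ν := by
  have hle : ∀ a, (max (g a) 0) ^ (1 + ε) ≤ |g a| ^ (1 + ε) := fun a =>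
    posPart_rpow_le_abs_rpow hε
  have hint : Integrable (fun a => (max (g a) 0) ^ (1 + ε)) ν := by
    refine Integrable.mono' hA ((hgm.max measurable_const).pow_const _).aestronglyMeasurable
      (Filter.Eventually.of_forall fun a => ?_)
    rw [Real.norm_eq_abs, abs_of_nonneg (Real.rpow_nonneg (le_max_right _ _) _)]
    exact hle a
  exact ⟨hint, integral_mono hint hA hle⟩

/-- `(g⁻)^{1+ε} ∈ L¹(ν)` from `|g|^{1+ε} ∈ L¹(ν)`, with `∫ (g⁻)^{1+ε} ≤ ∫ |g|^{1+ε}`. [ours] -/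
theorem integrable_negPart_rpow (hgm : Measurable g) (hε : 0 ≤ 1 + ε)
    (hA : Integrable (fun a => |g a| ^ (1 + ε)) ν) :
    Integrable (fun a => (max (-g a) 0) ^ (1 + ε)) ν
      ∧ ∫ a, (max (-g a) 0) ^ (1 + ε) ∂ν ≤ ∫ a, |g a| ^ (1 + ε) ∂ν := by
  have hle : ∀ a, (max (-g a) 0) ^ (1 + ε) ≤ |g a| ^ (1 + ε) := fun a =>
    negPart_rpow_le_abs_rpow hε
  have hint : Integrable (fun a => (max (-g a) 0) ^ (1 + ε)) ν := by
    refine Integrable.mono' hA ((hgm.neg.max measurable_const).pow_const _).aestronglyMeasurable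
      (Filter.Eventually.of_forall fun a => ?_)
    rw [Real.norm_eq_abs, abs_of_nonneg (Real.rpow_nonneg (le_max_right _ _) _)]
    exact hle a
  exact ⟨hint, integral_mono hint hA hle⟩

/-- A `(1 + ε)`-th ABSOLUTE moment on a probability space gives integrability of a signed score.
[ours] -/
theorem integrable_of_abs_rpow_moment [IsProbabilityMeasure ν] (hgm : Measurable g)
    (hε : 0 ≤ ε) (hA : Integrable (fun a => |g a| ^ (1 + ε)) ν) : Integrable g ν := by
  have habs : Measurable fun a => |g a| := hgm.abs
  have h := integrable_of_rpow_moment (ν := ν) habs (fun a => abs_nonneg _) hε hA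
  exact (integrable_norm_iff hgm.aestronglyMeasurable).1
    (by simpa only [Real.norm_eq_abs] using h)

end Parts

/-! ## §2 The signed block mean and its median under a `(1 + ε)`-th absolute moment -/

section BlockMean

variable {Ω : Type*} [MeasurableSpace Ω] {P : Measure Ω} [IsProbabilityMeasure P]
variable {X : Type*} [MeasurableSpace X] {ν : Measure X} {g : X → ℝ} {ε : ℝ} {n m R : ℕ}

/-- **THE BLOCK MEAN OF A SIGNED SCORE UNDER A `(1 + ε)`-TH ABSOLUTE MOMENT.**  `g` measurable
with `A = ∫ |g|^{1+ε} dν < ∞`, `0 < ε ≤ 1`, `m ≥ 1` i.i.d. draws, `η > 0`: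
`P(η ≤ |Σ_j g(x_j)/m − ∫ g dν|) ≤ 40A/(m^ε η^{1+ε})` (positive and negative parts at `η/2` each).
[ours] -/
theorem blockMean_heavyTail_signed_iid {x : Fin m → Ω → X} (hxm : ∀ j, Measurable (x j))
    (hind : iIndepFun x P) (hlaw : ∀ j, Measure.map (x j) P = ν) (hgm : Measurable g)
    (hε0 : 0 < ε) (hε1 : ε ≤ 1) (hA : Integrable (fun a => |g a| ^ (1 + ε)) ν) (hm : 1 ≤ m)
    {η : ℝ} (hη : 0 < η) :
    P.real {ω | η ≤ |(∑ j : Fin m, g (x j ω)) / m - ∫ a, g a ∂ν|}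
      ≤ 40 * (∫ a, |g a| ^ (1 + ε) ∂ν) / ((m : ℝ) ^ ε * η ^ (1 + ε)) := by
  haveI hν : IsProbabilityMeasure ν :=
    isProbabilityMeasure_of_map_eq_iid (hxm ⟨0, hm⟩) (hlaw ⟨0, hm⟩)
  have hε' : (0 : ℝ) ≤ 1 + ε := by linarith
  obtain ⟨hPi, hPle⟩ := integrable_posPart_rpow (ν := ν) hgm hε' hA
  obtain ⟨hNi, hNle⟩ := integrable_negPart_rpow (ν := ν) hgm hε' hA
  have hPm : Measurable fun a => max (g a) 0 := hgm.max measurable_const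
  have hNm : Measurable fun a => max (-g a) 0 := hgm.neg.max measurable_const
  have hη2 : 0 < η / 2 := by linarith
  -- the two non-negative parts at radius `η/2`
  have hP := blockMean_heavyTail_iid hxm hind hlaw hPm (fun a => le_max_right _ _) hε0 hε1 hPi
    hm hη2
  have hN := blockMean_heavyTail_iid hxm hind hlaw hNm (fun a => le_max_right _ _) hε0 hε1 hNi
    hm hη2
  -- integrability of the parts and the split of the population mean
  have hPi1 : Integrable (fun a => max (g a) 0) ν :=
    integrable_of_rpow_moment hPm (fun a => le_max_right _ _) hε0.le hPi
  have hNi1 : Integrable (fun a => max (-g a) 0) ν :=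
    integrable_of_rpow_moment hNm (fun a => le_max_right _ _) hε0.le hNi
  have hsplit : ∫ a, g a ∂ν = (∫ a, max (g a) 0 ∂ν) - ∫ a, max (-g a) 0 ∂ν := by
    rw [← integral_sub hPi1 hNi1]
    exact integral_congr_ae (Filter.Eventually.of_forall fun a =>
      (max_zero_sub_max_neg_zero_eq_self (g a)).symm)
  -- the bad event is covered by the two half-radius events
  have hsub : {ω | η ≤ |(∑ j : Fin m, g (x j ω)) / m - ∫ a, g a ∂ν|}
      ⊆ {ω | η / 2 ≤ |(∑ j : Fin m, max (g (x j ω)) 0) / m - ∫ a, max (g a) 0 ∂ν|}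
        ∪ {ω | η / 2 ≤ |(∑ j : Fin m, max (-g (x j ω)) 0) / m - ∫ a, max (-g a) 0 ∂ν|} := by
    intro ω hω
    simp only [Set.mem_setOf_eq, Set.mem_union] at hω ⊢
    by_contra hcon
    simp only [not_or, not_le] at hcon
    obtain ⟨h1, h2⟩ := hcon
    have e : (∑ j : Fin m, g (x j ω)) / m - ∫ a, g a ∂ν
        = ((∑ j : Fin m, max (g (x j ω)) 0) / m - ∫ a, max (g a) 0 ∂ν)
          - ((∑ j : Fin m, max (-g (x j ω)) 0) / m - ∫ a, max (-g a) 0 ∂ν) := by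
      have es : ∑ j : Fin m, g (x j ω)
          = ∑ j : Fin m, max (g (x j ω)) 0 - ∑ j : Fin m, max (-g (x j ω)) 0 := by
        rw [← sum_sub_distrib]
        exact Finset.sum_congr rfl fun j _ => (max_zero_sub_max_neg_zero_eq_self _).symm
      rw [es, hsplit]
      ring
    rw [e] at hω
    have := abs_sub _ _ |>.trans_lt (add_lt_add h1 h2)
    linarith
  -- constants: `5A^±/(m^ε (η/2)^{1+ε}) ≤ 20A/(m^ε η^{1+ε})`
  have hm0 : (0 : ℝ) < m := by exact_mod_cast hm
  have hmε : 0 < (m : ℝ) ^ ε := Real.rpow_pos_of_pos hm0 _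
  have hD : 0 < (m : ℝ) ^ ε * η ^ (1 + ε) := mul_pos hmε (Real.rpow_pos_of_pos hη _)
  have hD2 : 0 < (m : ℝ) ^ ε * (η / 2) ^ (1 + ε) := mul_pos hmε (Real.rpow_pos_of_pos hη2 _)
  have hA0 : 0 ≤ ∫ a, |g a| ^ (1 + ε) ∂ν :=
    integral_nonneg fun a => Real.rpow_nonneg (abs_nonneg _) _
  have hhalf : η ^ (1 + ε) / 4 ≤ (η / 2) ^ (1 + ε) := rpow_half_ge hη.le hε1
  have hkey : ∀ {A' : ℝ}, A' ≤ ∫ a, |g a| ^ (1 + ε) ∂ν →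
      5 * A' / ((m : ℝ) ^ ε * (η / 2) ^ (1 + ε))
        ≤ 20 * (∫ a, |g a| ^ (1 + ε) ∂ν) / ((m : ℝ) ^ ε * η ^ (1 + ε)) := by
    intro A' hA'
    rw [div_le_div_iff₀ hD2 hD]
    have h1 : 5 * A' * ((m : ℝ) ^ ε * η ^ (1 + ε))
        ≤ 5 * (∫ a, |g a| ^ (1 + ε) ∂ν) * ((m : ℝ) ^ ε * η ^ (1 + ε)) :=
      mul_le_mul_of_nonneg_right (by linarith) hD.le
    have h2 : 5 * (∫ a, |g a| ^ (1 + ε) ∂ν) * ((m : ℝ) ^ ε * η ^ (1 + ε))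
        ≤ 20 * (∫ a, |g a| ^ (1 + ε) ∂ν) * ((m : ℝ) ^ ε * (η / 2) ^ (1 + ε)) := by
      have : (∫ a, |g a| ^ (1 + ε) ∂ν) * ((m : ℝ) ^ ε * η ^ (1 + ε))
          ≤ 4 * ((∫ a, |g a| ^ (1 + ε) ∂ν) * ((m : ℝ) ^ ε * (η / 2) ^ (1 + ε))) := by
        have h4 : (m : ℝ) ^ ε * η ^ (1 + ε) ≤ 4 * ((m : ℝ) ^ ε * (η / 2) ^ (1 + ε)) := by
          nlinarith [mul_le_mul_of_nonneg_left hhalf hmε.le]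
        nlinarith [mul_le_mul_of_nonneg_left h4 hA0]
      linarith
    exact h1.trans h2
  calc P.real {ω | η ≤ |(∑ j : Fin m, g (x j ω)) / m - ∫ a, g a ∂ν|}
      ≤ P.real ({ω | η / 2 ≤ |(∑ j : Fin m, max (g (x j ω)) 0) / m - ∫ a, max (g a) 0 ∂ν|}
          ∪ {ω | η / 2 ≤ |(∑ j : Fin m, max (-g (x j ω)) 0) / m - ∫ a, max (-g a) 0 ∂ν|}) :=
        measureReal_mono hsub
    _ ≤ _ := measureReal_union_le _ _
    _ ≤ 20 * (∫ a, |g a| ^ (1 + ε) ∂ν) / ((m : ℝ) ^ ε * η ^ (1 + ε))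
        + 20 * (∫ a, |g a| ^ (1 + ε) ∂ν) / ((m : ℝ) ^ ε * η ^ (1 + ε)) :=
        add_le_add (hP.trans (hkey hPle)) (hN.trans (hkey hNle))
    _ = 40 * (∫ a, |g a| ^ (1 + ε) ∂ν) / ((m : ℝ) ^ ε * η ^ (1 + ε)) := by ring

/-- **MEDIAN OF SIGNED BLOCK MEANS UNDER A `(1 + ε)`-TH ABSOLUTE MOMENT.**  `n` independent draws
`y_j` with common law `ν`; `g` measurable, `A = ∫ |g|^{1+ε} dν < ∞`, `0 < ε ≤ 1`; `m ≥ 1`,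
`R·m ≤ n`, `η > 0` with `160A ≤ m^ε η^{1+ε}`:
`P( #{r < R : η ≤ |Ḡ_r − ∫ g dν|} ≥ R/2 ) ≤ exp(−R/8)`. [ours] -/
theorem blockMean_medianOfBlocks_confidence_heavyTail_signed {y : Fin n → Ω → X}
    (hym : ∀ j, Measurable (y j)) (hind : iIndepFun y P) (hlaw : ∀ j, Measure.map (y j) P = ν)
    (hgm : Measurable g) (hε0 : 0 < ε) (hε1 : ε ≤ 1)
    (hA : Integrable (fun a => |g a| ^ (1 + ε)) ν) (hm : 1 ≤ m) (hRm : R * m ≤ n) {η : ℝ}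
    (hη : 0 < η) (hvt : 160 * ∫ a, |g a| ^ (1 + ε) ∂ν ≤ (m : ℝ) ^ ε * η ^ (1 + ε)) :
    P.real {ω | (R : ℝ) / 2 ≤ #{r ∈ (univ : Finset (Fin R)) | η ≤
        |(∑ j : Fin m, g (y ⟨((r : Fin R) : ℕ) * m + j, mul_add_lt hRm r j⟩ ω)) / m
          - ∫ a, g a ∂ν|}} ≤ exp (-(R / 8)) := by
  have hm0 : (0 : ℝ) < m := by exact_mod_cast hm
  have hD : 0 < (m : ℝ) ^ ε * η ^ (1 + ε) :=
    mul_pos (Real.rpow_pos_of_pos hm0 _) (Real.rpow_pos_of_pos hη _)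
  have hg' : Measurable fun (v : Fin m → X) => (∑ j : Fin m, g (v j)) / (m : ℝ) :=
    (Finset.measurable_sum _ fun (j : Fin m) _ => hgm.comp (measurable_pi_apply j)).div_const _
  have hYind : iIndepFun (fun (r : Fin R) ω =>
      (∑ j : Fin m, g (y ⟨(r : ℕ) * m + j, mul_add_lt hRm r j⟩ ω)) / (m : ℝ)) P :=
    iIndepFun_blockFun hym hind hRm hg'
  have hYm : ∀ r : Fin R, Measurable fun ω =>
      (∑ j : Fin m, g (y ⟨(r : ℕ) * m + j, mul_add_lt hRm r j⟩ ω)) / (m : ℝ) := fun r => by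
    have hblk : Measurable fun ω => fun (i : Fin m) => y ⟨(r : ℕ) * m + i, mul_add_lt hRm r i⟩ ω :=
      measurable_pi_lambda _ fun i => hym _
    exact hg'.comp hblk
  have hfar : ∀ r ∈ (univ : Finset (Fin R)), P.real {ω | η ≤
      |(∑ j : Fin m, g (y ⟨(r : ℕ) * m + j, mul_add_lt hRm r j⟩ ω)) / m - ∫ a, g a ∂ν|}
        ≤ 1 / 4 := by
    intro r _
    refine (blockMean_heavyTail_signed_iid
      (x := fun (i : Fin m) => y ⟨(r : ℕ) * m + i, mul_add_lt hRm r i⟩) (fun i => hym _)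
      (iIndepFun_block hind hRm r) (fun i => hlaw _) hgm hε0 hε1 hA hm hη).trans ?_
    rw [div_le_iff₀ hD]
    linarith
  have h := measureReal_half_far_le (μ := P) (univ : Finset (Fin R)) hYind hYm (∫ a, g a ∂ν) η
    hfar
  simpa only [card_univ, Fintype.card_fin] using h

/-- **The same for ANY sample-median selection** `med(ω)` of the `R` signed block means:
`160A ≤ m^ε η^{1+ε}` ⇒ `P(η ≤ |med − ∫ g dν|) ≤ exp(−R/8)`. [ours] -/
theorem blockMean_sampleMedian_confidence_heavyTail_signed {y : Fin n → Ω → X}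
    (hym : ∀ j, Measurable (y j)) (hind : iIndepFun y P) (hlaw : ∀ j, Measure.map (y j) P = ν)
    (hgm : Measurable g) (hε0 : 0 < ε) (hε1 : ε ≤ 1)
    (hA : Integrable (fun a => |g a| ^ (1 + ε)) ν) (hm : 1 ≤ m) (hRm : R * m ≤ n) {η : ℝ}
    (hη : 0 < η) (hvt : 160 * ∫ a, |g a| ^ (1 + ε) ∂ν ≤ (m : ℝ) ^ ε * η ^ (1 + ε))
    {med : Ω → ℝ}
    (hlo : ∀ ω, (R : ℝ) / 2 ≤ #{r ∈ (univ : Finset (Fin R)) | med ω ≤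
        (∑ j : Fin m, g (y ⟨((r : Fin R) : ℕ) * m + j, mul_add_lt hRm r j⟩ ω)) / m})
    (hhi : ∀ ω, (R : ℝ) / 2 ≤ #{r ∈ (univ : Finset (Fin R)) |
        (∑ j : Fin m, g (y ⟨((r : Fin R) : ℕ) * m + j, mul_add_lt hRm r j⟩ ω)) / m ≤ med ω}) :
    P.real {ω | η ≤ |med ω - ∫ a, g a ∂ν|} ≤ exp (-(R / 8)) := by
  refine (measureReal_mono ?_).trans
    (blockMean_medianOfBlocks_confidence_heavyTail_signed hym hind hlaw hgm hε0 hε1 hA hm hRm hη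
      hvt)
  intro ω hω
  simp only [Set.mem_setOf_eq] at hω ⊢
  by_contra hlt
  push Not at hlt
  have hR : (#(univ : Finset (Fin R)) : ℝ) = R := by rw [card_univ, Fintype.card_fin]
  have h := abs_median_sub_lt_of_card_lt (univ : Finset (Fin R)) _ (hR ▸ hlo ω) (hR ▸ hhi ω)
    (hR ▸ hlt)
  linarith

end BlockMean

end Summit.Ventures.LatticeQCDFlow.Scoring.HeavyTailMedian

end
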